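import Literature.Analysis.InnerProduct.IkedaIsospectralLensSpaces
import HarnessLib

/-!
# Ikeda's Lemma 2.3: if `φ(q)` is prime to `n`, all `(2n−1)`-dimensional lens spaces with fundamental group of order `q`
# are mutually homotopy equivalent (Ikeda 1980, §2)

Layer `Literature/Analysis/InnerProduct`, namespace `Literature.Analysis.InnerProduct`; lane `lit-hodgefound`, prover seat
`lit-hodgefound-p06`, generation 46, row g46-#4. THEOREMS only (no definition, no instance, no notation, no named fact).
Uses the homotopy criterion `LensWeightsHomotopyEquivalent` of `HigherLensSpaceMultiplicity.lean` (Ikeda's Theorem 2.2,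
the tree's dictionary definition of "homotopy equivalent" for lens spaces) and Mathlib's `powCoprime`.

## Source, verbatim (held text `paper:doi-10-24033-asens-1384`)

A. Ikeda, *On lens spaces which are isospectral but not isometric*, Ann. Sci. ÉNS (4) **13** (1980) 303–315, §2 (p. 310):
"**Theorem 2.2** (cf. [2], [3]). Let `L` and `L'` be as in the above Theorem. Then `L` is homotopy equivalent to `L'` if and
only if there are numbers `l` and `e ∈ {−1, 1}` such that `s₁⋯s_n ≡ elⁿp₁⋯p_n (mod q)`. **Lemma 2.3.** If `φ(q)` is prime to
`n`, then all the `(2n−1)`-dimensional lens spaces with fundamental group of order `q` are mutually homotopy equivalent to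
each other. *Proof.* If `φ(q)` is prime to `n`, then the homomorphism `g → gⁿ` of `K_q` into itself is an isomorphism. Now,
the Lemma follows directly from Theorem 2.2. Q.E.D." (`K_q` = the multiplicative group of residues prime to `q`, §1.)
§4 (p. 313): "(I) 5-dimensional examples (`n = 3`). Case (i): `q = 11`. Then `q₀ = 5`, `k = 2` and `r = 2`. `{1,1,3} ↦
L(11 : 1, 2, 2²)`, `{1,2,2} ↦ L(11 : 1, 2, 2³)`. Since `k = 2`, these lens spaces are isospectral. On the other hand,
`(φ(q), n) = (10, 3) = 1`. Hence, by Lemma 2.3, the lens space `L(11 : 1, 2, 2²)` is homotopy equivalent to `L(11 : 1, 2, 2³)`."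

## What is proved

* **`lensWeightsHomotopyEquivalent_of_coprime_totient`** (LEMMA 2.3 for every `q ≥ 1`: `gcd(φ(q), n) = 1` and `p, s` weight
  systems prime to `q` ⇒ `LensWeightsHomotopyEquivalent q p s`; with `P = ∏pᵢ`, `S = ∏sᵢ` units of `ℤ/q` and `|(ℤ/q)ˣ| =
  φ(q)`, the bijection `g ↦ gⁿ` (`powCoprime`) yields `l` with `lⁿ = SP⁻¹`), **`lensWeightsHomotopyEquivalent_of_prime_of_coprime`**
  (`q` prime, `gcd(q − 1, n) = 1`), **`lensWeightsHomotopyEquivalent_eleven_of_isCoprime`** (Example (I)(i) in general form: all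
  5-dimensional lens spaces with fundamental group of order `11` are mutually homotopy equivalent — the tree's
  `lensWeightsHomotopyEquivalent_eleven` is the instance `(1,2,4) ~ (1,2,8)`), `not_coprime_totient_thirteen` (the hypothesis
  fails for `q = 13`, `n = 3, 4`, where rows g44-#3/#4 exhibit non-homotopy-equivalent lens spaces).

## References

* [Ikeda1980] A. Ikeda, *On lens spaces which are isospectral but not isometric*, Ann. Sci. ÉNS (4) 13 (1980) 303–315, Theorem
  2.2, Lemma 2.3, §4 Example (I) Case (i).
-/

noncomputable section

open Finset

namespace Literature.Analysis.InnerProduct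

/-- Units of `ℤ/q` from integers prime to `q`, and their products. [folklore] -/
private theorem isUnit_prod_intCast_l23 {q : ℕ} {n : ℕ} {p : Fin n → ℤ} (hp : ∀ i, IsCoprime (p i) q) :
    IsUnit (∏ i, ((p i : ℤ) : ZMod q)) :=
  IsUnit.prod_univ_iff.mpr fun i ↦ (ZMod.coe_int_isUnit_iff_isCoprime _ _).mpr (hp i).symm

/-- **LEMMA 2.3 (Ikeda 1980): "If `φ(q)` is prime to `n`, then all the `(2n−1)`-dimensional lens spaces with fundamental
group of order `q` are mutually homotopy equivalent to each other."** In terms of the homotopy criterion of Theorem 2.2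
(`LensWeightsHomotopyEquivalent q p s`: `s₁⋯s_n ≡ ±lⁿp₁⋯p_n (mod q)` for some `l`): if `gcd(φ(q), n) = 1` then any two weight
systems `p, s` of `n` integers prime to `q` satisfy it — "the homomorphism `g ↦ gⁿ` of `K_q = (ℤ/q)ˣ` into itself is an
isomorphism" (`|K_q| = φ(q)`; Mathlib's `powCoprime`), so `(s₁⋯s_n)(p₁⋯p_n)⁻¹ = lⁿ` for some unit `l`. [cite: Ikeda1980,
Lemma 2.3 (with Theorem 2.2)] -/
theorem lensWeightsHomotopyEquivalent_of_coprime_totient {q : ℕ} [NeZero q] {n : ℕ} (hn : (Nat.totient q).Coprime n)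
    {p s : Fin n → ℤ} (hp : ∀ i, IsCoprime (p i) q) (hs : ∀ i, IsCoprime (s i) q) :
    LensWeightsHomotopyEquivalent q p s := by
  classical
  -- the units `P = p₁⋯p_n`, `S = s₁⋯s_n` of `ℤ/q`
  obtain ⟨P, hP⟩ := isUnit_prod_intCast_l23 hp
  obtain ⟨S, hS⟩ := isUnit_prod_intCast_l23 hs
  -- `g ↦ gⁿ` is a bijection of `(ℤ/q)ˣ`, a group of order `φ(q)` prime to `n`
  have hcard : (Nat.card (ZMod q)ˣ).Coprime n := by
    rwa [Nat.card_eq_fintype_card, ZMod.card_units_eq_totient]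
  obtain ⟨g, hg⟩ : ∃ g : (ZMod q)ˣ, g ^ n = S * P⁻¹ := ⟨(powCoprime hcard).symm (S * P⁻¹), by
    rw [← powCoprime_apply hcard, Equiv.apply_symm_apply]⟩
  -- an integer representative `l` of `g`
  refine ⟨((g : ZMod q).val : ℤ), 1, Or.inl rfl, ?_⟩
  rw [← ZMod.intCast_eq_intCast_iff]
  push_cast
  rw [ZMod.natCast_zmod_val, ← hS, ← hP, one_mul, ← Units.val_pow_eq_pow_val, hg]
  push_cast
  rw [mul_assoc, Units.inv_mul, mul_one]

/-- **LEMMA 2.3 for a prime `q`**: if `gcd(q − 1, n) = 1` then all `(2n−1)`-dimensional lens spaces `L(q : p₁, …, p_n)` are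
mutually homotopy equivalent (`φ(q) = q − 1`). [cite: Ikeda1980, Lemma 2.3] -/
theorem lensWeightsHomotopyEquivalent_of_prime_of_coprime {q : ℕ} (hq : q.Prime) {n : ℕ} (hn : (q - 1).Coprime n)
    {p s : Fin n → ℤ} (hp : ∀ i, IsCoprime (p i) q) (hs : ∀ i, IsCoprime (s i) q) :
    LensWeightsHomotopyEquivalent q p s := by
  haveI : NeZero q := ⟨hq.ne_zero⟩
  exact lensWeightsHomotopyEquivalent_of_coprime_totient (by rwa [Nat.totient_prime hq]) hp hs

/-- **Example (I), Case (i) of Ikeda 1980 in general form**: "`(φ(q), n) = (10, 3) = 1`. Hence, by Lemma 2.3, the lens space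
`L(11 : 1, 2, 2²)` is homotopy equivalent to `L(11 : 1, 2, 2³)`" — indeed ALL 5-dimensional lens spaces with fundamental
group of order `11` are mutually homotopy equivalent (the tree's `lensWeightsHomotopyEquivalent_eleven` is the instance
`(1, 2, 4) ~ (1, 2, 8)`). [cite: Ikeda1980, §4 Example (I) Case (i), Lemma 2.3] -/
theorem lensWeightsHomotopyEquivalent_eleven_of_isCoprime {p s : Fin 3 → ℤ} (hp : ∀ i, IsCoprime (p i) 11)
    (hs : ∀ i, IsCoprime (s i) 11) : LensWeightsHomotopyEquivalent 11 p s :=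
  lensWeightsHomotopyEquivalent_of_prime_of_coprime (by norm_num) (by norm_num) hp hs

/-- By contrast, for `q = 13` and `n = 3` or `n = 4` the hypothesis of Lemma 2.3 fails (`gcd(12, 3) = 3`, `gcd(12, 4) = 4`),
and indeed the tree exhibits non-homotopy-equivalent 5- and 7-dimensional lens spaces with fundamental group of order `13`
(`not_lensWeightsHomotopyEquivalent_thirteen_one_two_four`, `not_lensWeightsHomotopyEquivalent_thirteen`).
[cite: Ikeda1980, §4 Examples (I) Case (ii) and (II)] -/
theorem not_coprime_totient_thirteen : ¬ (Nat.totient 13).Coprime 3 ∧ ¬ (Nat.totient 13).Coprime 4 := by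
  rw [Nat.totient_prime (by norm_num)]
  norm_num

end Literature.Analysis.InnerProduct
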